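import Mathlib
import Summits.QuantumFields.YangMills.Theorems.TransverseWardBLFluxSectors
import Summits.QuantumFields.YangMills.Theorems.ScalingWindowSplitSelfNormalisedSkewnessWitnessChart
import Summits.QuantumFields.YangMills.Theorems.ScalingWindowSplitSelfNormalisedSkewnessStubAbelianPushforward
import HarnessLib

/-!
# The sector chart: the small-field cut of Wilson `U(1)₄` as a union of convex polytopes in `V = im d`

Route-independent helper for the crux stmt-QuantumFields-23103 `Theses.TransverseWardBL.ConvexPhaseCoexactBound`
(route `TransverseWardBL`, LINE g9-C of the ideator seat ym-idea-4; abelian `U(1)` line onto the leaf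
`Theorems.U1HelicityGapTorusD4` — nothing here bears on the Yang–Mills mass gap).

For a flux sector `k` (fluxes `2πk_{μν}` through the origin planes) with reference integer field `n_k`
(`TransverseWardBLFluxSectors`), put `c_k = 2π n_k ∈ (2πℤ)^P` and let `P_k = {v ∈ V | ∀ p, |v_p + c_{k,p}| ≤ 1}`
(a convex polytope of the space `V` of exact plaquette vectors).  The `Γ`-periodised sum (period lattice
`Γ = V ∩ (2πℤ)^P`) of `v ↦ 1_{P_k}(v) g(v + c_k)` evaluated at `ρ(U) = d(arg ∘ U)` collapses to
`g(ω(U))` if `U` lies in the cut AND in sector `k`, and to `0` otherwise (`tsum_sector_of_mem`,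
`tsum_sector_of_not_mem`); the tree's abelian pushforward (Weil formula,
`SelfNormalisedSkewness.Negative.stub_abelianPushforward`) then gives the **sector chart identity**
`∫ 1_{G_k}(U) g(ω(U)) dHaar^E(U) = c · ∫_{P_k} g(v + c_k) dvol_V(v)` with ONE constant `c ∈ (0,∞)` for all
sectors and all measurable `g ≥ 0` (`exists_sectorChart_constant`).
-/

noncomputable section

open scoped BigOperators ENNReal
open MeasureTheory Finset
open Literature.MathematicalPhysics.QuantumLattice Literature.MathematicalPhysics.QuantumFieldTheory
open Summit.QuantumFields.YangMills.Theorems.SelfNormalisedSkewness.Negative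

namespace Summit.QuantumFields.YangMills.Theorems.TransverseWardBL

variable {S : ℕ} [NeZero S]

/-! ### The surviving period -/

omit [NeZero S] in
/-- **A term of the periodised sum that meets the sector box reproduces the plaquette angles**: if
`|(ρ(U) + γ)_p + c_{k,p}| ≤ 1` for all `p` (`γ ∈ Γ`, `c_k ∈ (2πℤ)^P`), then `ρ(U) + γ + c_k = ω(U)`
(coordinatewise both sides are congruent mod `2π` and closer than `2π`). [folklore] -/
theorem periodised_term_eq (U : GaugeConfig 4 S Circle) (k : {q : Fin 4 × Fin 4 // q.1 < q.2} → ℤ)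
    (γ : {v : LinearMap.range (plaqCoboundary S) //
      ∀ p : Plaquette 4 S, ∃ m : ℤ, (v : EuclideanSpace ℝ (Plaquette 4 S)) p = 2 * Real.pi * m})
    (h : ∀ p : Plaquette 4 S, |((rhoV U + (γ : LinearMap.range (plaqCoboundary S)) :
        LinearMap.range (plaqCoboundary S)) : EuclideanSpace ℝ (Plaquette 4 S)) p +
      2 * Real.pi * ((if p.1 p.2.1.1 = 0 ∧ p.1 p.2.1.2 = 0 then k p.2 else 0 : ℤ) : ℝ)| ≤ 1) :
    ((rhoV U + (γ : LinearMap.range (plaqCoboundary S)) : LinearMap.range (plaqCoboundary S)) :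
        EuclideanSpace ℝ (Plaquette 4 S)) +
      WithLp.toLp 2 (fun p : Plaquette 4 S =>
        2 * Real.pi * ((if p.1 p.2.1.1 = 0 ∧ p.1 p.2.1.2 = 0 then k p.2 else 0 : ℤ) : ℝ)) = plaqAngle U := by
  obtain ⟨m, hm⟩ := exists_int_plaqCoboundary_arg_eq U
  ext p
  obtain ⟨a, ha⟩ := γ.2 p
  set nk : ℤ := if p.1 p.2.1.1 = 0 ∧ p.1 p.2.1.2 = 0 then k p.2 else 0 with hnk
  have hval : (((rhoV U + (γ : LinearMap.range (plaqCoboundary S)) : LinearMap.range (plaqCoboundary S)) :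
        EuclideanSpace ℝ (Plaquette 4 S)) + WithLp.toLp 2 (fun p : Plaquette 4 S =>
        2 * Real.pi * ((if p.1 p.2.1.1 = 0 ∧ p.1 p.2.1.2 = 0 then k p.2 else 0 : ℤ) : ℝ))) p =
      plaqAngle U p + (m p + a + nk : ℤ) * (2 * Real.pi) := by
    simp only [Submodule.coe_add, coe_rhoV, PiLp.add_apply, hm p, ha, ← hnk]
    push_cast; ring
  have hp := h p
  have hp' : |plaqAngle U p + (m p + a + nk : ℤ) * (2 * Real.pi)| ≤ 1 := by
    have : ((rhoV U + (γ : LinearMap.range (plaqCoboundary S)) : LinearMap.range (plaqCoboundary S)) :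
        EuclideanSpace ℝ (Plaquette 4 S)) p + 2 * Real.pi * (nk : ℝ) =
        plaqAngle U p + (m p + a + nk : ℤ) * (2 * Real.pi) := by
      simp only [Submodule.coe_add, coe_rhoV, PiLp.add_apply, hm p, ha]
      push_cast; ring
    rw [hnk] at this
    rwa [this] at hp
  have hdiff : |(plaqAngle U p + (m p + a + nk : ℤ) * (2 * Real.pi)) - plaqAngle U p| < 2 * Real.pi := by
    have hlo := neg_pi_lt_abelianFieldTensor U p.1 p.2.1.1 p.2.1.2
    have hhi := abelianFieldTensor_le_pi U p.1 p.2.1.1 p.2.1.2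
    rw [← plaqAngle_apply] at hlo hhi
    rw [abs_le] at hp'
    rw [abs_lt]
    constructor <;> linarith [hp'.1, hp'.2, Real.pi_gt_three]
  have h0 := eq_zero_of_intCast_mul_two_pi_of_abs_lt (k := m p + a + nk) (by ring) hdiff
  rw [hval]
  exact sub_eq_zero.1 h0

/-! ### The periodised sector indicator -/

/-- **In sector `k` the periodised sum reproduces `g(ω(U))`.** [folklore] -/
theorem tsum_sector_of_mem (g : EuclideanSpace ℝ (Plaquette 4 S) → ℝ≥0∞)
    (k : {q : Fin 4 × Fin 4 // q.1 < q.2} → ℤ) (U : GaugeConfig 4 S Circle)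
    (hU : ∀ p : Plaquette 4 S, |plaqAngle U p| ≤ 1) (hk : ∀ o, magneticFlux U 0 o.1.1 o.1.2 = 2 * Real.pi * k o) :
    (∑' γ : {v : LinearMap.range (plaqCoboundary S) //
        ∀ p : Plaquette 4 S, ∃ m : ℤ, (v : EuclideanSpace ℝ (Plaquette 4 S)) p = 2 * Real.pi * m},
      {v : LinearMap.range (plaqCoboundary S) | ∀ p : Plaquette 4 S,
          |(v : EuclideanSpace ℝ (Plaquette 4 S)) p +
            2 * Real.pi * ((if p.1 p.2.1.1 = 0 ∧ p.1 p.2.1.2 = 0 then k p.2 else 0 : ℤ) : ℝ)| ≤ 1}.indicator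
        (fun v => g ((v : EuclideanSpace ℝ (Plaquette 4 S)) + WithLp.toLp 2 (fun p : Plaquette 4 S =>
          2 * Real.pi * ((if p.1 p.2.1.1 = 0 ∧ p.1 p.2.1.2 = 0 then k p.2 else 0 : ℤ) : ℝ))))
        (rhoV U + (γ : LinearMap.range (plaqCoboundary S)))) = g (plaqAngle U) := by
  classical
  set cv : EuclideanSpace ℝ (Plaquette 4 S) := WithLp.toLp 2 (fun p : Plaquette 4 S =>
    2 * Real.pi * ((if p.1 p.2.1.1 = 0 ∧ p.1 p.2.1.2 = 0 then k p.2 else 0 : ℤ) : ℝ)) with hcv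
  set Pk : Set (LinearMap.range (plaqCoboundary S)) := {v | ∀ p : Plaquette 4 S,
    |(v : EuclideanSpace ℝ (Plaquette 4 S)) p +
      2 * Real.pi * ((if p.1 p.2.1.1 = 0 ∧ p.1 p.2.1.2 = 0 then k p.2 else 0 : ℤ) : ℝ)| ≤ 1} with hPk
  have hmem := plaqAngle_sub_ref_mem_range hU k hk
  obtain ⟨m, hm⟩ := exists_int_plaqCoboundary_arg_eq U
  -- the surviving period
  set w : LinearMap.range (plaqCoboundary S) := ⟨plaqAngle U - cv, hmem⟩ with hw
  have hγ₀ : ∀ p : Plaquette 4 S, ∃ a : ℤ,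
      ((w - rhoV U : LinearMap.range (plaqCoboundary S)) : EuclideanSpace ℝ (Plaquette 4 S)) p = 2 * Real.pi * a :=
    fun p => ⟨-m p - (if p.1 p.2.1.1 = 0 ∧ p.1 p.2.1.2 = 0 then k p.2 else 0), by
      simp only [hw, Submodule.coe_sub, coe_rhoV, PiLp.sub_apply, hcv, hm p]
      push_cast; ring⟩
  set γ₀ : {v : LinearMap.range (plaqCoboundary S) //
      ∀ p : Plaquette 4 S, ∃ m : ℤ, (v : EuclideanSpace ℝ (Plaquette 4 S)) p = 2 * Real.pi * m} :=
    ⟨w - rhoV U, hγ₀⟩ with hγ₀def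
  have hsum : rhoV U + (γ₀ : LinearMap.range (plaqCoboundary S)) = w := by simp [hγ₀def]
  have hwc : (w : EuclideanSpace ℝ (Plaquette 4 S)) + cv = plaqAngle U := by simp [hw]
  rw [tsum_eq_single γ₀]
  · rw [hsum, Set.indicator_of_mem, hwc]
    intro p
    have : (w : EuclideanSpace ℝ (Plaquette 4 S)) p +
        2 * Real.pi * ((if p.1 p.2.1.1 = 0 ∧ p.1 p.2.1.2 = 0 then k p.2 else 0 : ℤ) : ℝ) = plaqAngle U p := by
      have := congrArg (fun z : EuclideanSpace ℝ (Plaquette 4 S) => z p) hwc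
      simpa [hcv] using this
    rw [this]; exact hU p
  · intro γ hne
    rw [Set.indicator_of_notMem]
    intro hγ
    apply hne
    have heq := periodised_term_eq U k γ hγ
    rw [← hwc] at heq
    have heq' : ((rhoV U + (γ : LinearMap.range (plaqCoboundary S)) : LinearMap.range (plaqCoboundary S)) :
        EuclideanSpace ℝ (Plaquette 4 S)) = (w : EuclideanSpace ℝ (Plaquette 4 S)) := add_right_cancel heq
    have h3 : rhoV U + (γ : LinearMap.range (plaqCoboundary S)) = rhoV U + (γ₀ : LinearMap.range (plaqCoboundary S)) := by
      rw [hsum]; exact Subtype.ext heq'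
    exact Subtype.ext (add_left_cancel h3)

/-- **Off sector `k` (or off the cut) the periodised sum vanishes.** [folklore] -/
theorem tsum_sector_of_not_mem (g : EuclideanSpace ℝ (Plaquette 4 S) → ℝ≥0∞)
    (k : {q : Fin 4 × Fin 4 // q.1 < q.2} → ℤ) (U : GaugeConfig 4 S Circle)
    (h : ¬ ((∀ p : Plaquette 4 S, |plaqAngle U p| ≤ 1) ∧ ∀ o, magneticFlux U 0 o.1.1 o.1.2 = 2 * Real.pi * k o)) :
    (∑' γ : {v : LinearMap.range (plaqCoboundary S) //
        ∀ p : Plaquette 4 S, ∃ m : ℤ, (v : EuclideanSpace ℝ (Plaquette 4 S)) p = 2 * Real.pi * m},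
      {v : LinearMap.range (plaqCoboundary S) | ∀ p : Plaquette 4 S,
          |(v : EuclideanSpace ℝ (Plaquette 4 S)) p +
            2 * Real.pi * ((if p.1 p.2.1.1 = 0 ∧ p.1 p.2.1.2 = 0 then k p.2 else 0 : ℤ) : ℝ)| ≤ 1}.indicator
        (fun v => g ((v : EuclideanSpace ℝ (Plaquette 4 S)) + WithLp.toLp 2 (fun p : Plaquette 4 S =>
          2 * Real.pi * ((if p.1 p.2.1.1 = 0 ∧ p.1 p.2.1.2 = 0 then k p.2 else 0 : ℤ) : ℝ))))
        (rhoV U + (γ : LinearMap.range (plaqCoboundary S)))) = 0 := by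
  classical
  refine ENNReal.tsum_eq_zero.2 fun γ => ?_
  rw [Set.indicator_of_notMem]
  intro hγ
  apply h
  have heq := periodised_term_eq U k γ hγ
  have hU : ∀ p : Plaquette 4 S, |plaqAngle U p| ≤ 1 := fun p => by
    have := congrArg (fun z : EuclideanSpace ℝ (Plaquette 4 S) => z p) heq
    simp only [PiLp.add_apply] at this
    rw [← this]
    simpa using hγ p
  refine ⟨hU, fun o => flux_eq_of_sub_ref_mem_range hU k ?_ o⟩
  rw [← heq, add_sub_cancel_right]
  exact (rhoV U + (γ : LinearMap.range (plaqCoboundary S))).2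

/-! ### Measurability -/

/-- The sector box `P_k ⊂ V` is measurable (closed). [folklore] -/
theorem measurableSet_sectorBox (c : Plaquette 4 S → ℝ) :
    MeasurableSet {v : LinearMap.range (plaqCoboundary S) | ∀ p : Plaquette 4 S,
      |(v : EuclideanSpace ℝ (Plaquette 4 S)) p + c p| ≤ 1} := by
  have : {v : LinearMap.range (plaqCoboundary S) | ∀ p : Plaquette 4 S,
      |(v : EuclideanSpace ℝ (Plaquette 4 S)) p + c p| ≤ 1} =
      ⋂ p, {v : LinearMap.range (plaqCoboundary S) |
        |(v : EuclideanSpace ℝ (Plaquette 4 S)) p + c p| ≤ 1} := by ext v; simp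
  rw [this]
  refine MeasurableSet.iInter fun p => (isClosed_le ?_ continuous_const).measurableSet
  exact (((EuclideanSpace.proj p : EuclideanSpace ℝ (Plaquette 4 S) →L[ℝ] ℝ).continuous.comp
    continuous_subtype_val).add continuous_const).abs

/-! ### The sector chart identity -/

/-- **The sector chart identity.**  There is a constant `c ∈ (0, ∞)` (depending on `S` only) such that for
every flux sector `k` and every measurable `g : ℝ^P → [0, ∞]`,
`∫ 1_{G_k}(U) g(ω(U)) dHaar^E(U) = c · ∫_V 1_{P_k}(v) g(v + c_k) dvol(v)`, where `G_k` = (cut) ∩ (sector `k`),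
`c_k = 2π n_k` and `P_k = {v ∈ V | ∀ p, |v_p + c_{k,p}| ≤ 1}`. [folklore] -/
theorem exists_sectorChart_constant (S : ℕ) [NeZero S] :
    ∃ c : ℝ≥0∞, c ≠ 0 ∧ c ≠ ⊤ ∧ ∀ (k : {q : Fin 4 × Fin 4 // q.1 < q.2} → ℤ)
      (g : EuclideanSpace ℝ (Plaquette 4 S) → ℝ≥0∞), Measurable g →
      ∫⁻ U, {U : GaugeConfig 4 S Circle | (∀ p : Plaquette 4 S, |plaqAngle U p| ≤ 1) ∧
          ∀ o : {q : Fin 4 × Fin 4 // q.1 < q.2}, magneticFlux U 0 o.1.1 o.1.2 = 2 * Real.pi * k o}.indicator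
          (fun U => g (plaqAngle U)) U ∂(Measure.pi fun _ : Edge 4 S => haarProbability Circle) =
        c * ∫⁻ v : LinearMap.range (plaqCoboundary S),
          {v : LinearMap.range (plaqCoboundary S) | ∀ p : Plaquette 4 S,
            |(v : EuclideanSpace ℝ (Plaquette 4 S)) p +
              2 * Real.pi * ((if p.1 p.2.1.1 = 0 ∧ p.1 p.2.1.2 = 0 then k p.2 else 0 : ℤ) : ℝ)| ≤ 1}.indicator
            (fun v => g ((v : EuclideanSpace ℝ (Plaquette 4 S)) + WithLp.toLp 2 (fun p : Plaquette 4 S =>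
              2 * Real.pi * ((if p.1 p.2.1.1 = 0 ∧ p.1 p.2.1.2 = 0 then k p.2 else 0 : ℤ) : ℝ)))) v := by
  classical
  obtain ⟨c, hc0, hctop, hc⟩ := stub_abelianPushforward (plaqIncidence S) (plaqCoboundary S) (plaqCoboundary_eq_sum S)
  refine ⟨c, hc0, hctop, fun k g hg => ?_⟩
  set cv : EuclideanSpace ℝ (Plaquette 4 S) := WithLp.toLp 2 (fun p : Plaquette 4 S =>
    2 * Real.pi * ((if p.1 p.2.1.1 = 0 ∧ p.1 p.2.1.2 = 0 then k p.2 else 0 : ℤ) : ℝ)) with hcv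
  set Pk : Set (LinearMap.range (plaqCoboundary S)) := {v | ∀ p : Plaquette 4 S,
    |(v : EuclideanSpace ℝ (Plaquette 4 S)) p +
      2 * Real.pi * ((if p.1 p.2.1.1 = 0 ∧ p.1 p.2.1.2 = 0 then k p.2 else 0 : ℤ) : ℝ)| ≤ 1} with hPk
  set F : LinearMap.range (plaqCoboundary S) → ℝ≥0∞ :=
    Pk.indicator (fun v => g ((v : EuclideanSpace ℝ (Plaquette 4 S)) + cv)) with hF
  have hFm : Measurable F := by
    refine Measurable.indicator (hg.comp ?_) (measurableSet_sectorBox _)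
    exact (continuous_subtype_val.add continuous_const).measurable
  rw [← hc F hFm]
  set Gk : Set (GaugeConfig 4 S Circle) := {U | (∀ p : Plaquette 4 S, |plaqAngle U p| ≤ 1) ∧
      ∀ o : {q : Fin 4 × Fin 4 // q.1 < q.2}, magneticFlux U 0 o.1.1 o.1.2 = 2 * Real.pi * k o} with hGk
  refine lintegral_congr fun U => ?_
  by_cases hUk : U ∈ Gk
  · rw [Set.indicator_of_mem hUk]
    obtain ⟨h1, h2⟩ := hUk
    exact (tsum_sector_of_mem g k U h1 h2).symm
  · rw [Set.indicator_of_notMem hUk]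
    exact (tsum_sector_of_not_mem g k U hUk).symm

end Summit.QuantumFields.YangMills.Theorems.TransverseWardBL

end
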